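import Mathlib
import Summits.HodgeConjecture.FermatCycles.HodgeFermatTheoremUEq
import Summits.HodgeConjecture.FermatCycles.HodgeFermatQuadEnum
import Summits.HodgeConjecture.FermatCycles.HodgeFermatCorollaryUStatement
import Summits.HodgeConjecture.FermatCycles.HodgeFermatPropDPrimeNFinal

/-!
# THEOREM U, shared-entry form, at EVERY odd level — including 21 and 39 (`HodgeFermat/TheoremUShared.lean` + `TheoremUSharedFinal.lean`; HF-G27c); closes the statement `ThmUShared`

Tree copy of 2 modules of the sibling cell's standalone package `run/shared/lean/pub/pub-hodgefermat/lean/HodgeFermat/`, concatenated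
IN DEPENDENCY ORDER in one tree file (each module's body byte-identical to its source lines, its own `namespace … end` block kept):
  1. `HodgeFermat/TheoremUShared.lean` (190 lines, sha256 `f94b78ba2a5b2cab…`), source lines 26–33 and 58–190 (`sharedEqAt_of_eqAt`,
     `rsum_eq_of_sameType`, `sharedEqAt_of_quadCheck` — the levels where the kernel quadruple enumeration holds —, `sharedEqAt_21`,
     `sharedEqAt_39`, `thmUShared_of : ThmUEq → ThmUShared`, `thmUSharedMultiset_of`, `thmUSharedMultiset_of_thmUEq`) — pub-hodgefermat
     `CERT.md` l.918, GATE HF-G27c; cell record `check/ThmUShared_standalone.lean` rc 0 (`--axioms …thmUSharedMultiset_of_thmUEq` = the trio);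
  2. `HodgeFermat/TheoremUSharedFinal.lean` (35 lines, sha256 `127c91862488a521…`), source lines 20–35 (all: `thmUShared : ThmUShared`,
     `thmUSharedMultiset`, `sharedEqAt` — unconditional, from the landed THEOREM U⁼ `TheoremUEq.thmUEq`, `HodgeFermatPropDPrimeNFinal.lean`) —
     GATE HF-G27c; cell record the link check `check/ThmUSharedLink_standalone.lean` (`--axioms …thmUShared` = the trio + exactly the
     postulated `TheoremUEq.thmUEq`, a theorem of this tree since 2026-08-25).
The statements `SharedEqAt`/`ThmUShared`/`ThmUSharedMultiset` (source l.35–56) were filed first (`HodgeFermatCorollaryUStatement.lean`).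
Filed by cell `pub-hfermat`, seat prover-1 gen-5, on the COORDINATOR KEEPER RULING of 2026-08-25 (gem sweep H1: take the
off-gate kernel theorem `thmFstar` through the gate; every form of THEOREM F* is on-gate since 2026-08-25/26, gen-0/2/3/4), as
successor work of the same verbatim-port kind: the sibling's off-gate gate records HF-G27 / HF-G27b / HF-G27c — COROLLARY U′
(all-unit Hodge multisets with few distinct residues are sums of pairs), its printed-threshold forms U♯, and THEOREM U in
shared-entry form — on top of the landed LEMMA W / THEOREM U / U⁺ / U⁼ chain (`HodgeFermatTheoremU.lean`,
`HodgeFermatLemmaWFourier.lean`, `HodgeFermatTheoremUPlus.lean`, `HodgeFermatTheoremUEq.lean`, `HodgeFermatPropDPrimeNFinal.lean`).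
Deviations from the source modules, exhaustively: the `import` lines (`…HodgeFermatTheoremUEq` for `import HodgeFermat.TheoremUEq`,
`…HodgeFermatQuadEnum` for `import HodgeFermat.QuadEnum`, `…HodgeFermatPropDPrimeNFinal` for `import HodgeFermat.TheoremUEqFinal` (landed
inside that multi-module file), `…HodgeFermatCorollaryUStatement` for the three definitions filed first, NOT re-declared here; module 2's
`import HodgeFermat.TheoremUShared` points inside this file); this docstring (replacing the modules' docstrings, both quoted below);
one-line docstrings added (gate lint) to `val_tmul_natCast`, `val_tmul_neg_natCast`, `sharedEqAt_39`, `thmUSharedMultiset_of`,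
`thmUSharedMultiset_of_thmUEq`.  Every other line — in particular every declaration's statement and proof — is byte-identical to its
source.  Trust base: no hypotheses in `thmUShared`, no `sorry`; axioms = [propext, Classical.choice, Quot.sound].
HONEST FRAMING: explicit algebraic cycles for specific Hodge classes on Fermat/Delsarte varieties; residual open instances
listed; no claim on general Hodge.  (This file is arithmetic of CM types / finite combinatorics of the sibling's KR-free
programme; it claims nothing about cycles.)

(1) The docstring of `HodgeFermat/TheoremUShared.lean` (l.7–24), verbatim:

## THEOREM U, shared-entry form, at EVERY odd level — including `21` and `39` (HF-G27c)

`TheoremUEq.thmUEq` (THEOREM U⁼) says that at an odd level `N ∉ {21, 39}` two all-unit triples with zero sum and the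
same CM type are permutations of each other.  At `N = 21` and `N = 39` this fails — but ONLY through DISJOINT pairs:
this LIGHT module (imports `TheoremUEq` and `QuadEnum` only) proves that at EVERY odd level two all-unit triples
`T = (a, b, c)`, `T' = (a', b', c')` of the same CM type which SHARE AN ENTRY (`a ≡ a' (mod N)`) coincide as unordered
triples of residues (`ThmUShared`, from `ThmUEq` as a hypothesis: `thmUShared_of`; the no-binder form is
`TheoremUSharedFinal.thmUShared`).

The new case is `N ∈ {21, 39}` (`sharedEqAt_of_quadCheck`, in fact any level `N > 1` at which the kernel enumeration
`QuadEnum.quadCheck N = true` holds): the quadruple `Q = {b, c, −b', −c'}` is an all-unit multiset with zero sum whose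
scaled lengths are all `2N` — because the residue sums of `tT` and `tT'` agree for every unit `t` (same CM type, both
sums in `{N, 2N}`) and `⟨ta⟩ = ⟨ta'⟩` — so by `QuadEnum.twoPairs_of_quadCheck` it is two pairs `{x, −x}`; the pairing
`b + c ≡ 0` would force `N ∣ a`, and the two other pairings say `{b, c} ≡ {b', c'}`.  This is the all-unit case of the
"coincidences with a common element" clause of THEOREM C⁻ (`tables/SEMI-THEOREM.md` §3), classification-free and at every
odd level: an all-unit shared coincidence of CM types is trivial.

(2) The docstring of `HodgeFermat/TheoremUSharedFinal.lean` (l.7–18), verbatim: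

## THEOREM U, shared-entry form, at every odd level — unconditional (HF-G27c)

`thmUShared : ThmUShared` — at EVERY odd level `N` (including `21` and `39`), two all-unit triples with zero sum, the
same CM type and a common entry are permutations of each other mod `N` — from THEOREM U⁼ (`TheoremUEq.thmUEq`,
generation 27) at `N ∉ {21, 39}` and the kernel quadruple enumeration (`QuadEnum.quadCheck_21/39`) at the two
exceptional levels (`TheoremUShared.thmUShared_of`).  Hub records: `check/ThmUShared_standalone.lean`
(`--axioms …thmUSharedMultiset_of_thmUEq` = the three) and the link check `check/ThmUSharedLink_standalone.lean` (this
module verbatim over `thmUEq` postulated: `--axioms …thmUShared` = the three + exactly `HodgeFermat.KRFree.TheoremUEq.thmUEq`).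
Consequently every non-trivial coincidence of CM types between all-unit triples at an odd level is a DISJOINT pair at
level `21` or `39`.
-/

-- ════════════════════════════════════════════════════════════════════════════════════════════════
-- module 1/2: HodgeFermat/TheoremUShared.lean (source lines 26–33, 58–190)
-- ════════════════════════════════════════════════════════════════════════════════════════════════

set_option autoImplicit false

namespace HodgeFermat.KRFree.TheoremUShared

open HodgeFermat.KRFree.LemmaN HodgeFermat.KRFree.TheoremUEq HodgeFermat.KRFree.QuadEnum
open Literature.AlgebraicGeometry.HodgeTheory.FermatCharacter

/-! ## Statements -/

-- `def SharedEqAt`, `def ThmUShared`, `def ThmUSharedMultiset` (source l.35–56): filed first, `HodgeFermatCorollaryUStatement.lean`.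

/-- the equality form at a level trivially gives the shared-entry form there. -/
theorem sharedEqAt_of_eqAt {N : ℕ} (h : EqAt N) : SharedEqAt N :=
  fun a b c a' b' c' hs hs' ha hb hc ha' hb' hc' hT _ => h a b c a' b' c' hs hs' ha hb hc ha' hb' hc' hT

/-! ## Same CM type ⟹ equal residue sums at every unit -/

/-- For all-unit triples with zero sum, the same CM type means `rsum(tT) = rsum(tT')` for every unit `t`
(both sums lie in `{N, 2N}`, and `t ∈ H` iff the sum is `N`). -/
lemma rsum_eq_of_sameType {N a b c a' b' c' t : ℕ} (h1 : 1 < N)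
    (hs : N ∣ a + b + c) (hs' : N ∣ a' + b' + c') (hc : Nat.Coprime c N) (hc' : Nat.Coprime c' N)
    (hT : SameType N (a, b, c) (a', b', c')) (ht : Nat.Coprime t N) :
    rsum N (a, b, c) t = rsum N (a', b', c') t := by
  have hN : 0 < N := by omega
  have h := rsum_cases (x := a) (y := b) (t := t) hN hs (not_dvd_mul_unit h1 ht hc)
  have h' := rsum_cases (x := a') (y := b') (t := t) hN hs' (not_dvd_mul_unit h1 ht hc')
  have hiff := hT t ht
  rcases h.1 with e | e <;> rcases h'.1 with e' | e'
  · rw [e, e']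
  · have hin : rsum N (a', b', c') t = N := h'.2.mp (hiff.mp (h.2.mpr e))
    omega
  · have hin : rsum N (a, b, c) t = N := h.2.mp (hiff.mpr (h'.2.mpr e'))
    omega
  · rw [e, e']

/-! ## Values of `τ·x` and `τ·(−x)` in `ℤ/N` -/

/-- `val (τ • x) = τ · x mod N` for `τ < N` -/
lemma val_tmul_natCast {N : ℕ} [NeZero N] (τ : ℕ) (hτ : τ < N) (x : ℕ) :
    (((τ : ℕ) : ZMod N) * (x : ZMod N)).val = τ * x % N := by
  rw [val_mul_nat τ hτ, ZMod.val_natCast, Nat.mul_mod_mod]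

/-- `val (τ • (−x)) = N − τ · x mod N` for a unit `x` and `0 < τ < N` coprime to `N` -/
lemma val_tmul_neg_natCast {N : ℕ} [NeZero N] (h1 : 1 < N) (τ : ℕ) (hτN : τ < N) (hτ : Nat.Coprime τ N)
    (x : ℕ) (hx : Nat.Coprime x N) :
    (((τ : ℕ) : ZMod N) * -(x : ZMod N)).val = N - τ * x % N := by
  have hv := val_tmul_natCast τ hτN x
  have hne : ((τ : ℕ) : ZMod N) * (x : ZMod N) ≠ 0 := by
    intro h0
    have h := congrArg ZMod.val h0
    rw [hv, ZMod.val_zero] at h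
    exact not_dvd_mul_unit h1 hτ hx (Nat.dvd_of_mod_eq_zero h)
  rw [mul_neg, ZMod.neg_val, if_neg hne, hv]

/-! ## The levels where the quadruple enumeration is available (`21`, `39`) -/

/-- **Shared-entry uniqueness from the quadruple enumeration**: at a level `N > 1` with `quadCheck N = true`, two all-unit
triples with zero sum, the same CM type and a common entry are permutations of each other.  (The quadruple
`{b, c, −b', −c'}` is an all-unit Hodge quadruple, hence two pairs.) -/
theorem sharedEqAt_of_quadCheck {N : ℕ} (h1 : 1 < N) (hq : quadCheck N = true) : SharedEqAt N := by
  haveI : NeZero N := ⟨by omega⟩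
  haveI : Fact (1 < N) := ⟨h1⟩
  intro a b c a' b' c' hs hs' ha hb hc ha' hb' hc' hT haa
  -- the entries as units of `ℤ/N`
  have uA : IsUnit (a : ZMod N) := (ZMod.isUnit_iff_coprime a N).mpr ha
  have uB : IsUnit (b : ZMod N) := (ZMod.isUnit_iff_coprime b N).mpr hb
  have uC : IsUnit (c : ZMod N) := (ZMod.isUnit_iff_coprime c N).mpr hc
  have uB' : IsUnit (b' : ZMod N) := (ZMod.isUnit_iff_coprime b' N).mpr hb'
  have uC' : IsUnit (c' : ZMod N) := (ZMod.isUnit_iff_coprime c' N).mpr hc'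
  -- zero sums and the common entry
  have e1 : ((a : ZMod N)) + (b : ZMod N) + (c : ZMod N) = 0 := by
    have h := (ZMod.natCast_eq_zero_iff (a + b + c) N).mpr hs
    push_cast at h
    exact h
  have e2 : ((a' : ZMod N)) + (b' : ZMod N) + (c' : ZMod N) = 0 := by
    have h := (ZMod.natCast_eq_zero_iff (a' + b' + c') N).mpr hs'
    push_cast at h
    exact h
  have e3 : (a : ZMod N) = (a' : ZMod N) := (ZMod.natCast_eq_natCast_iff' a a' N).mpr haa
  -- the quadruple `Q = (b, c, -b', -c')` has zero sum …
  have hsum : (b : ZMod N) + (c : ZMod N) + (-(b' : ZMod N)) + (-(c' : ZMod N)) = 0 := by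
    linear_combination e1 - e2 - e3
  -- … and all its scaled lengths are `2N`
  have hH : ∀ t : (ZMod N)ˣ, 2 * mNormSum ((({(b : ZMod N), (c : ZMod N), -(b' : ZMod N), -(c' : ZMod N)} :
      Multiset (ZMod N))).map fun x => (t : ZMod N) * x) = N * 4 := by
    intro t
    obtain ⟨τ, hτN, hτ, ht⟩ : ∃ τ : ℕ, τ < N ∧ Nat.Coprime τ N ∧ (t : ZMod N) = ((τ : ℕ) : ZMod N) :=
      ⟨(t : ZMod N).val, ZMod.val_lt _, ZMod.val_coe_unit_coprime t, (ZMod.natCast_zmod_val _).symm⟩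
    have hrs := rsum_eq_of_sameType h1 hs hs' hc hc' hT hτ
    simp only [rsum] at hrs
    have haa' : τ * a % N = τ * a' % N := by rw [Nat.mul_mod, haa, ← Nat.mul_mod]
    have hb'N : τ * b' % N < N := Nat.mod_lt _ (by omega)
    have hc'N : τ * c' % N < N := Nat.mod_lt _ (by omega)
    have hms : mNormSum ((({(b : ZMod N), (c : ZMod N), -(b' : ZMod N), -(c' : ZMod N)} :
        Multiset (ZMod N))).map fun x => (t : ZMod N) * x) =
        ((t : ZMod N) * (b : ZMod N)).val + ((t : ZMod N) * (c : ZMod N)).val +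
          ((t : ZMod N) * -(b' : ZMod N)).val + ((t : ZMod N) * -(c' : ZMod N)).val := by
      simp only [mNormSum, Multiset.insert_eq_cons, Multiset.map_cons, Multiset.map_singleton, Multiset.sum_cons,
        Multiset.sum_singleton]
      ring
    rw [hms, ht, val_tmul_natCast τ hτN b, val_tmul_natCast τ hτN c, val_tmul_neg_natCast h1 τ hτN hτ b' hb',
      val_tmul_neg_natCast h1 τ hτN hτ c' hc']
    omega
  -- so `Q` is two pairs
  have hpairs := twoPairs_of_quadCheck hq uB uC uB'.neg uC'.neg hsum hH
  rcases hpairs with ⟨hbc, _⟩ | ⟨hbb, hcc⟩ | ⟨hbc', hcb'⟩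
  · -- `b + c ≡ 0` forces `a ≡ 0`: impossible for a unit
    have hA0 : (a : ZMod N) = 0 := by linear_combination e1 - hbc
    exact absurd hA0 uA.ne_zero
  · -- `b ≡ b'`, `c ≡ c'`
    refine Or.inl ⟨haa, ?_, ?_⟩
    · exact (ZMod.natCast_eq_natCast_iff' b b' N).mp (by linear_combination hbb)
    · exact (ZMod.natCast_eq_natCast_iff' c c' N).mp (by linear_combination hcc)
  · -- `b ≡ c'`, `c ≡ b'`
    refine Or.inr (Or.inl ⟨haa, ?_, ?_⟩)
    · exact (ZMod.natCast_eq_natCast_iff' b c' N).mp (by linear_combination hbc')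
    · exact (ZMod.natCast_eq_natCast_iff' c b' N).mp (by linear_combination hcb')

/-- the two exceptional levels of THEOREM U⁼. -/
theorem sharedEqAt_21 : SharedEqAt 21 := sharedEqAt_of_quadCheck (by norm_num) quadCheck_21

/-- the second exceptional level of THEOREM U⁼ -/
theorem sharedEqAt_39 : SharedEqAt 39 := sharedEqAt_of_quadCheck (by norm_num) quadCheck_39

/-! ## Every odd level -/

/-- **THEOREM U, shared-entry form, at every odd level**, from THEOREM U⁼ (`ThmUEq`, odd `N ∉ {21, 39}`) and the
quadruple enumeration at `21` and `39`. -/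
theorem thmUShared_of (hU : ThmUEq) : ThmUShared := by
  intro N h2
  by_cases h21 : N = 21
  · subst h21
    exact sharedEqAt_21
  by_cases h39 : N = 39
  · subst h39
    exact sharedEqAt_39
  exact sharedEqAt_of_eqAt
    (fun a b c a' b' c' hs hs' ha hb hc ha' hb' hc' hT => hU N a b c a' b' c' h2 h21 h39 hs hs' ha hb hc ha' hb' hc' hT)

/-- the multiset form from the shared-entry form -/
theorem thmUSharedMultiset_of (h : ThmUShared) : ThmUSharedMultiset :=
  fun N a b c a' b' c' h2 hs hs' ha hb hc ha' hb' hc' hT haa =>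
    zmod_multiset_eq (h N h2 a b c a' b' c' hs hs' ha hb hc ha' hb' hc' hT haa)

/-- the multiset form from THEOREM U⁼ -/
theorem thmUSharedMultiset_of_thmUEq (hU : ThmUEq) : ThmUSharedMultiset :=
  thmUSharedMultiset_of (thmUShared_of hU)

end HodgeFermat.KRFree.TheoremUShared

-- ════════════════════════════════════════════════════════════════════════════════════════════════
-- module 2/2: HodgeFermat/TheoremUSharedFinal.lean (source lines 20–35)
-- ════════════════════════════════════════════════════════════════════════════════════════════════

set_option autoImplicit false

namespace HodgeFermat.KRFree.TheoremUShared

open HodgeFermat.KRFree.TheoremUEq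

/-- **THEOREM U, shared-entry form, at every odd level** (no binders). -/
theorem thmUShared : ThmUShared := thmUShared_of thmUEq

/-- … as an equality of multisets `{a, b, c} = {a', b', c'}` in `ℤ/N`. -/
theorem thmUSharedMultiset : ThmUSharedMultiset := thmUSharedMultiset_of thmUShared

/-- the level-`N` statement. -/
theorem sharedEqAt (N : ℕ) (h2 : ¬ 2 ∣ N) : SharedEqAt N := thmUShared N h2

end HodgeFermat.KRFree.TheoremUShared
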